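import Summits.MatrixMultiplication.OmegaCensus.STPP211Z2pow6Cover
import Summits.MatrixMultiplication.OmegaCensus.STPP211Z2pow6CosetKills

/-!
# (2,1,1)¹⁰ ⊄ (ℤ/2)⁶ — part H4: every family has a REPRESENTATIVE normal form; all but the 11 hard classes are excluded

Cell `pub-omega` (unit `pub-omega-stpp-1-g37`), topic `Summits/MatrixMultiplication/OmegaCensus`.
HONEST FRAMING (verbatim): lottery ticket; floor = certified bounds/negative ranges. Census STRUCTURE bookkeeping (B5, `T1((ℤ/2)⁶)`, Pb237);
nothing here is a bound on `ω`.

**`exists_repNF`: every STPP family of size pattern `(2,1,1)¹⁰` in `G6 = (ℤ/2)⁶` has a translation normal form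
`(A'ᵢ, {0}, {dec rᵢ})` (all `#A'ᵢ = 2`) whose `c`-code LIST `r` is one of the 29 representatives `reps29`** (ENG2 g35's
`orbits_m6_k10.txt`: the `AGL(6,2)`-classes of ten-point subsets of `𝔽₂⁶` containing `0`). Chain of kernel-certified reductions:
`STPP211Z2pow6FrameNF.exists_frameNF` (per-member translation, `C`-shift, GL descent to a frame normal form `base d ∪ R`) →
`STPP211Z2pow6Cover.cover_spec` (a coordinate permutation onto one of 456 canonical sets; 44 672 kernel decisions) →
`STPP211Z2pow6NFCertsCheck.certs_spec` (shift + linear bijection onto the representative; 456 kernel-checked certificates) → re-indexing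
(`exists_sorted`). **`exists_hard11NF`**: combined with the 18 coset-law exclusions `T1CosetEng.noNF_csNN` (`STPP211Z2pow6CosetKills`),
every such family lies over one of the 11 HARD classes `hard11` (#7, #8, #9, #11, #17, #20, #21, #22, #23, #25, #27). What is NOT proved
here: the exclusion of the 11 hard classes (direct search, S2; engine ×2 NONE offline) — with it, `(2,1,1)¹⁰ ⊄ (ℤ/2)⁶`, i.e.
`T1((ℤ/2)⁶) = 9`.

References: H. Cohn, R. Kleinberg, B. Szegedy, C. Umans, FOCS 2005 (arXiv:math/0511460), Def. 5.1.
-/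

namespace Summit.MatrixMultiplication.OmegaCensus

namespace T1Z2p6

open Finset Literature.Computability.AlgebraicComplexity

/-! ## H4: from a frame normal form to a representative normal form -/

/-- Reading `reps29_ok` for one representative: ten pairwise distinct codes `< 64`. -/
theorem reps29_spec {r : List ℕ} (hr : r ∈ reps29) : r.length = 10 ∧ r.Nodup ∧ ∀ x ∈ r, x < 64 := by
  have h := List.all_eq_true.1 reps29_ok.1.2 r hr
  simp only [Bool.and_eq_true, beq_iff_eq, decide_eq_true_eq, List.all_eq_true] at h
  exact ⟨h.1.1.1, h.1.1.2, fun x hx => h.1.2 x hx⟩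

/-- Reading `reps29_ok` for one certificate row: its representative index is in range. -/
theorem row_rep_spec {row : ℕ × List ℕ × ℕ × List ℕ × ℕ} (hrow : row ∈ certs) : 1 ≤ row.2.2.2.2 ∧ row.2.2.2.2 ≤ 29 := by
  have h := List.all_eq_true.1 reps29_ok.2 row hrow
  simp only [Bool.and_eq_true, Nat.ble_eq] at h
  exact ⟨h.1.1, h.1.2⟩

/-- The representative of a certificate row is one of the 29. -/
theorem row_rep_mem {row : ℕ × List ℕ × ℕ × List ℕ × ℕ} (hrow : row ∈ certs) : reps29.getD (row.2.2.2.2 - 1) [] ∈ reps29 := by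
  obtain ⟨h1, h2⟩ := row_rep_spec hrow
  have hlen : reps29.length = 29 := reps29_ok.1.1
  rw [List.getD_eq_getElem _ _ (by rw [hlen]; omega)]
  exact List.getElem_mem _

/-- Re-index a normal-form state whose `c`-SET is a representative so that its `c`-LIST is the representative. -/
theorem exists_sorted {A : Fin 10 → Finset G6} {c : Fin 10 → G6} (h : NFState A c) {r : List ℕ} (hr : r ∈ reps29)
    (hset : univ.image c = setOf r) : ∃ A' c', NFState A' c' ∧ ∀ i : Fin 10, c' i = dec (r.getD i.val 0) := by
  obtain ⟨hlen, hnd, hlt⟩ := reps29_spec hr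
  have hi : ∀ i : Fin 10, i.val < r.length := fun i => by rw [hlen]; exact i.isLt
  have hget : ∀ i : Fin 10, ∃ j, c j = dec (r.getD i.val 0) := by
    intro i
    have hm : r.getD i.val 0 ∈ r := by rw [List.getD_eq_getElem _ _ (hi i)]; exact List.getElem_mem _
    have : dec (r.getD i.val 0) ∈ univ.image c := by
      rw [hset, setOf, List.mem_toFinset, List.mem_map]; exact ⟨_, hm, rfl⟩
    obtain ⟨j, _, hj⟩ := mem_image.1 this
    exact ⟨j, hj⟩
  choose σ hσ using hget
  have hσinj : Function.Injective σ := by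
    intro i i' hii'
    have h1 := hσ i
    rw [hii', hσ i'] at h1
    have h2 := congrArg enc h1
    have hm : ∀ i : Fin 10, r.getD i.val 0 ∈ r := fun i => by rw [List.getD_eq_getElem _ _ (hi i)]; exact List.getElem_mem _
    rw [enc_dec _ (hlt _ (hm i')), enc_dec _ (hlt _ (hm i)), List.getD_eq_getElem _ _ (hi i'), List.getD_eq_getElem _ _ (hi i)] at h2
    exact Fin.ext ((hnd.getElem_inj_iff).1 h2).symm
  have hσbij : Function.Bijective σ := Finite.injective_iff_bijective.1 hσinj
  exact ⟨_, _, h.reindex (Equiv.ofBijective σ hσbij), fun i => hσ i⟩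

/-- **EVERY `(2,1,1)¹⁰` FAMILY OF `(ℤ/2)⁶` HAS A REPRESENTATIVE NORMAL FORM**: a translation-normal-form family `(A'ᵢ, {0}, {dec rᵢ})`
(all `#A'ᵢ = 2`) whose `c`-code LIST is one of the 29 representatives `reps29` of the `AGL(6,2)`-classes of ten-point sets containing `0`.
Chain: `exists_frameNF` (translation, `C`-shift, GL descent) → `cover_spec` (coordinate permutation onto a listed canonical set, kernel) →
`certs_spec` (shift + linear bijection onto the representative, kernel) → re-indexing. [cite: CohnKleinbergSzegedyUmans2005, Def. 5.1] -/
theorem exists_repNF {A B C : Fin 10 → Finset G6} (hS : IsSTPP A B C)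
    (hc : ∀ i, (A i).card = 2 ∧ (B i).card = 1 ∧ (C i).card = 1) :
    ∃ r ∈ reps29, ∃ A' : Fin 10 → Finset G6,
      IsSTPP A' (fun _ => ({0} : Finset G6)) (fun i => {dec (r.getD i.val 0)}) ∧ ∀ i, (A' i).card = 2 := by
  obtain ⟨d, hd, R, hR, A₁, c₁, hst, hcard, hset⟩ := exists_frameNF hS hc
  have h₁ : NFState A₁ c₁ := ⟨hst, hcard⟩
  obtain ⟨P, hP, row, hrow, himg⟩ := cover_spec hd hR
  -- the coordinate permutation
  have h₂ := h₁.map (lin P hP) (lin_injective P hP)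
  have hset₂ : univ.image (fun i => lin P hP (c₁ i)) = setOf row.2.1 := by
    rw [← himg, ← hset, Finset.image_image]; rfl
  -- the shift of the certificate
  have h₃ := h₂.shiftC (dec row.2.2.1)
  have hset₃ : univ.image (fun i => lin P hP (c₁ i) + dec row.2.2.1) = (setOf row.2.1).image (· + dec row.2.2.1) := by
    rw [← hset₂, Finset.image_image]; rfl
  -- the linear bijection of the certificate
  obtain ⟨hh, hcert⟩ := certs_spec row hrow
  have h₄ := h₃.map (lin row.2.2.2.1 hh) (lin_injective _ hh)
  have hset₄ : univ.image (fun i => lin row.2.2.2.1 hh (lin P hP (c₁ i) + dec row.2.2.1)) =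
      setOf (reps29.getD (row.2.2.2.2 - 1) []) := by
    rw [← hcert, ← hset₃, Finset.image_image]; rfl
  -- re-indexing
  obtain ⟨A₅, c₅, h₅, hlist⟩ := exists_sorted h₄ (row_rep_mem hrow) hset₄
  refine ⟨_, row_rep_mem hrow, A₅, ?_, h₅.card_two⟩
  have hc₅ : (fun i => ({c₅ i} : Finset G6)) = fun i => {dec ((reps29.getD (row.2.2.2.2 - 1) []).getD i.val 0)} := by
    funext i; rw [hlist i]
  rw [← hc₅]
  exact h₅.stpp

/-! ## The eleven hard classes -/

/-- The 11 representative `c`-code lists NOT killed by the coset law (classes #7, #8, #9, #11, #17, #20, #21, #22, #23, #25, #27 of `reps29`). -/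
def hard11 : List (List ℕ) := [
  [0, 1, 2, 3, 4, 8, 15, 16, 32, 51], [0, 1, 2, 3, 4, 8, 15, 16, 32, 63], [0, 1, 2, 3, 4, 8, 16, 28, 32, 44],
  [0, 1, 2, 4, 7, 8, 16, 31, 32, 47], [0, 1, 2, 4, 8, 14, 16, 23, 32, 39], [0, 1, 2, 4, 8, 15, 16, 23, 32, 39],
  [0, 1, 2, 4, 8, 15, 16, 23, 32, 43], [0, 1, 2, 4, 8, 15, 16, 23, 32, 56], [0, 1, 2, 4, 8, 16, 27, 32, 43, 51],
  [0, 1, 2, 4, 8, 16, 31, 32, 35, 44], [0, 1, 2, 4, 8, 16, 32, 39, 57, 62]]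

/-- `hard11` consists of representatives (lines 7, 8, 9, 11, 17, 20, 21, 22, 23, 25, 27 of `reps29`). -/
theorem hard11_sub : ∀ r ∈ hard11, r ∈ reps29 := by decide

open T1CosetEng in
/-- **EVERY `(2,1,1)¹⁰` FAMILY OF `(ℤ/2)⁶` LIES OVER ONE OF THE 11 HARD CLASSES**: it has a translation normal form `(A'ᵢ, {0}, {dec rᵢ})`
(all `#A'ᵢ = 2`) with `r ∈ hard11`. From `exists_repNF` (29 classes) and the 18 coset-law kills `T1CosetEng.noNF_csNN`
(`STPP211Z2pow6CosetKills`). So `(2,1,1)¹⁰ ⊄ (ℤ/2)⁶` (`T1((ℤ/2)⁶) = 9`) follows once the 11 hard classes are excluded (S2, direct search).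
[cite: CohnKleinbergSzegedyUmans2005, Def. 5.1] -/
theorem exists_hard11NF {A B C : Fin 10 → Finset G6} (hS : IsSTPP A B C)
    (hc : ∀ i, (A i).card = 2 ∧ (B i).card = 1 ∧ (C i).card = 1) :
    ∃ r ∈ hard11, ∃ A' : Fin 10 → Finset G6,
      IsSTPP A' (fun _ => ({0} : Finset G6)) (fun i => {dec (r.getD i.val 0)}) ∧ ∀ i, (A' i).card = 2 := by
  obtain ⟨r, hr, A', hst, hcard⟩ := exists_repNF hS hc
  have hex : ∃ A : Fin 10 → Finset G6, IsSTPP A (fun _ => ({0} : Finset G6)) (fun i => {dec (r.getD i.val 0)}) ∧ ∀ i, (A i).card = 2 :=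
    ⟨A', hst, hcard⟩
  simp only [reps29, List.mem_cons, List.mem_nil_iff, or_false] at hr
  rcases hr with rfl | rfl | rfl | rfl | rfl | rfl | rfl | rfl | rfl | rfl | rfl | rfl | rfl | rfl | rfl | rfl | rfl | rfl | rfl | rfl |
    rfl | rfl | rfl | rfl | rfl | rfl | rfl | rfl | rfl
  · exact absurd hex noNF_cs01
  · exact absurd hex noNF_cs02
  · exact absurd hex noNF_cs03
  · exact absurd hex noNF_cs04
  · exact absurd hex noNF_cs05
  · exact absurd hex noNF_cs06
  · exact ⟨_, by simp [hard11], A', hst, hcard⟩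
  · exact ⟨_, by simp [hard11], A', hst, hcard⟩
  · exact ⟨_, by simp [hard11], A', hst, hcard⟩
  · exact absurd hex noNF_cs10
  · exact ⟨_, by simp [hard11], A', hst, hcard⟩
  · exact absurd hex noNF_cs12
  · exact absurd hex noNF_cs13
  · exact absurd hex noNF_cs14
  · exact absurd hex noNF_cs15
  · exact absurd hex noNF_cs16
  · exact ⟨_, by simp [hard11], A', hst, hcard⟩
  · exact absurd hex noNF_cs18
  · exact absurd hex noNF_cs19
  · exact ⟨_, by simp [hard11], A', hst, hcard⟩
  · exact ⟨_, by simp [hard11], A', hst, hcard⟩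
  · exact ⟨_, by simp [hard11], A', hst, hcard⟩
  · exact ⟨_, by simp [hard11], A', hst, hcard⟩
  · exact absurd hex noNF_cs24
  · exact ⟨_, by simp [hard11], A', hst, hcard⟩
  · exact absurd hex noNF_cs26
  · exact ⟨_, by simp [hard11], A', hst, hcard⟩
  · exact absurd hex noNF_cs28
  · exact absurd hex noNF_cs29

end T1Z2p6

end Summit.MatrixMultiplication.OmegaCensus
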